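import Mathlib.Analysis.Calculus.ParametricIntegral
import Literature.Analysis.FluidPDE.ElgindiRadialDerivativeOperator
import HarnessLib

/-!
# Radial derivatives of the `K`-moment and of `L₁₂` of a test function
([Elgindi2021] §6.3, "`L₁₂` is smoothing in `θ`")

Topic `Literature/Analysis/FluidPDE`. Proof file (everything proved, no definitions, no named
facts) on the proof path of the named fact
`Literature.Analysis.FluidPDE.Elgindi.ElgindiGhoulMasmoudi2021_stabilityCore`
(`ElgindiStabilityDecomposition.lean`). T. M. Elgindi, Ann. of Math. 194 (2021) =
arXiv:1904.04795 (`[Elgindi2021]`), §6.3, proof of Proposition 6.13 (p. 18 of the held text):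

> "Observe that `|E₁|_{𝓗^{k−1}} ≤ C̄_k|f|_{𝓗^{k−1}}`. This is because `L₁₂` is actually smoothing in
> `θ` so that `L₁₂(D_θf)` and `L₁₂(f)` actually have the same regularity (they can both be bounded in
> `𝓗^{k−1}` by `f` in the same space)."

and Elgindi–Ghoul–Masmoudi 2021 (arXiv:1910.14071) §3.1, proof of Proposition 3.2 (the `D_y^j`
falling on the non-local terms). The calculus behind these remarks, for a test function `g`
(`Cⁿ`, compactly supported, support inside the open strip): the `K`-moment
`z ↦ (K, g(z,·))_{L²_θ} = ∫₀^{π/2} g(z,θ)K(θ)dθ` is `Cⁿ` with `D_z`-derivatives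
`D_z^m (K, g)_θ = (K, D_z^m g)_θ` (differentiation under the integral sign), and
`D_z L₁₂(g) = −(K, g)_θ`, so `D_z^{m+1}L₁₂(g) = −(K, D_z^m g)_θ`: every radial derivative of the
non-local terms of `𝓛_Γ^T` is a `K`-moment of a lower derivative of `g`, controlled in `L²(dz/z²)`
by `(9π/32)∬(D_z^m g·w)²` (`integral_sq_kMoment_div_sq_le`).
-/

noncomputable section

open MeasureTheory Set Function Real Filter
open _root_.Topology

namespace Literature.Analysis.FluidPDE

namespace Elgindi

/-! ### Global regularity of `∂_z g` and `D_z g` for a `Cⁿ⁺¹` function -/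

/-- `∂_z g ∈ Cⁿ(ℝ²)` for `g ∈ Cⁿ⁺¹(ℝ²)`. [folklore] -/
theorem contDiff_dz_of_contDiff {g : ℝ → ℝ → ℝ} {n : ℕ} (hg : ContDiff ℝ (n + 1) (uncurry g)) :
    ContDiff ℝ n (uncurry (dz g)) := by
  have h : ContDiff ℝ n fun p : ℝ × ℝ => fderiv ℝ (uncurry g) p (1, 0) :=
    (hg.fderiv_right le_rfl).clm_apply contDiff_const
  have e : uncurry (dz g) = fun p : ℝ × ℝ => fderiv ℝ (uncurry g) p (1, 0) :=
    funext fun p => dz_eq_fderiv ((hg.differentiable (by simp)) p)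
  rw [e]
  exact h

/-- `D_z g ∈ Cⁿ(ℝ²)` for `g ∈ Cⁿ⁺¹(ℝ²)` (no support condition). [folklore] -/
theorem contDiff_Dz_of_contDiff {g : ℝ → ℝ → ℝ} {n : ℕ} (hg : ContDiff ℝ (n + 1) (uncurry g)) :
    ContDiff ℝ n (uncurry (Dz g)) := by
  have h := contDiff_fst.mul (contDiff_dz_of_contDiff hg)
  have e : uncurry (Dz g) = fun p : ℝ × ℝ => p.1 * uncurry (dz g) p := by
    funext p
    simp only [Function.uncurry, Dz_eq_mul_dz]
  rw [e]
  exact h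

/-- Iterates: `D_z^m g ∈ Cⁿ` for `g ∈ C^{n+m}`. [folklore] -/
theorem contDiff_iterate_Dz_of_contDiff {g : ℝ → ℝ → ℝ} {m n : ℕ} (hg : ContDiff ℝ (n + m) (uncurry g)) :
    ContDiff ℝ n (uncurry (Dz^[m] g)) := by
  induction m generalizing g with
  | zero => simpa using hg
  | succ m ih =>
    rw [Function.iterate_succ_apply]
    refine ih (g := Dz g) (contDiff_Dz_of_contDiff ?_)
    have e : ((n + (m + 1) : ℕ) : WithTop ℕ∞) = (n + m : ℕ) + 1 := by push_cast; ring
    rw [← e]; exact hg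

/-- Iterates of `D_z` keep compact support. [folklore] -/
theorem hasCompactSupport_iterate_Dz {g : ℝ → ℝ → ℝ} (hs : HasCompactSupport (uncurry g)) (m : ℕ) :
    HasCompactSupport (uncurry (Dz^[m] g)) := by
  induction m generalizing g with
  | zero => simpa using hs
  | succ m ih => rw [Function.iterate_succ_apply]; exact ih (hasCompactSupport_Dz hs)

/-- Iterates of `D_z` do not enlarge the support. [folklore] -/
theorem tsupport_iterate_Dz_subset {g : ℝ → ℝ → ℝ} (m : ℕ) :
    tsupport (uncurry (Dz^[m] g)) ⊆ tsupport (uncurry g) := by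
  induction m generalizing g with
  | zero => simp
  | succ m ih => rw [Function.iterate_succ_apply]; exact (ih (g := Dz g)).trans tsupport_Dz_subset

/-! ### Differentiation of the `K`-moment under the integral sign -/

/-- **`(K, g(z,·))_θ` is differentiable in `z` with derivative `(K, ∂_zg(z,·))_θ`** for `g ∈ C¹`
compactly supported. [folklore] -/
theorem hasDerivAt_kMoment {g : ℝ → ℝ → ℝ} (hg : ContDiff ℝ 1 (uncurry g))
    (hs : HasCompactSupport (uncurry g)) (z : ℝ) :
    HasDerivAt (kMoment g) (kMoment (dz g) z) z := by
  have hgc : Continuous (uncurry g) := hg.continuous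
  have hdc : Continuous (uncurry (dz g)) := continuous_dz hg
  have hds : HasCompactSupport (uncurry (dz g)) := hasCompactSupport_dz hs
  obtain ⟨C, hC⟩ := hdc.bounded_above_of_compact_support hds
  obtain ⟨CK, hCK⟩ : ∃ CK, ∀ θ, ‖kernelK θ‖ ≤ CK := by
    refine ⟨3, fun θ => ?_⟩
    rw [Real.norm_eq_abs]
    unfold kernelK
    have h1 := Real.abs_sin_le_one θ
    have h2 := Real.abs_cos_le_one θ
    have h3 : |Real.sin θ| * |Real.cos θ| ^ 2 ≤ 1 :=
      mul_le_one₀ h1 (by positivity) (pow_le_one₀ (abs_nonneg _) h2)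
    rw [abs_mul, abs_mul, abs_pow, abs_of_pos (by norm_num : (0 : ℝ) < 3)]
    calc 3 * |Real.sin θ| * |Real.cos θ| ^ 2 = 3 * (|Real.sin θ| * |Real.cos θ| ^ 2) := by ring
      _ ≤ 3 * 1 := by gcongr
      _ = 3 := by ring
  set μ : Measure ℝ := volume.restrict (Ioo 0 (π / 2)) with hμ
  haveI : IsFiniteMeasure μ := by
    rw [hμ]
    exact ⟨by rw [Measure.restrict_apply_univ]; exact measure_Ioo_lt_top⟩
  have hF_meas : ∀ᶠ x in 𝓝 z, AEStronglyMeasurable (fun θ => g x θ * kernelK θ) μ :=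
    Filter.Eventually.of_forall fun x =>
      ((hgc.comp (Continuous.prodMk_right x)).mul continuous_kernelK).aestronglyMeasurable
  have hF_int : Integrable (fun θ => g z θ * kernelK θ) μ :=
    ((hgc.comp (Continuous.prodMk_right z)).mul continuous_kernelK).continuousOn.integrableOn_Icc.mono_set
      Ioo_subset_Icc_self
  have hF'_meas : AEStronglyMeasurable (fun θ => dz g z θ * kernelK θ) μ :=
    ((hdc.comp (Continuous.prodMk_right z)).mul continuous_kernelK).aestronglyMeasurable
  have h_bound : ∀ᵐ θ ∂μ, ∀ x ∈ (univ : Set ℝ), ‖dz g x θ * kernelK θ‖ ≤ C * CK :=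
    Filter.Eventually.of_forall fun θ x _ => by
      rw [norm_mul]
      exact mul_le_mul (hC (x, θ)) (hCK θ) (norm_nonneg _) ((norm_nonneg _).trans (hC (x, θ)))
  have h_diff : ∀ᵐ θ ∂μ, ∀ x ∈ (univ : Set ℝ), HasDerivAt (fun x => g x θ * kernelK θ) (dz g x θ * kernelK θ) x :=
    Filter.Eventually.of_forall fun θ x _ => by
      have hd : DifferentiableAt ℝ (uncurry g) (x, θ) := (hg.differentiable (by simp)) (x, θ)
      have h1 : HasDerivAt (fun x' => g x' θ) (dz g x θ) x := by
        rw [dz_eq_fderiv hd]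
        exact hasDerivAt_slice_fst hd
      exact h1.mul_const _
  exact (hasDerivAt_integral_of_dominated_loc_of_deriv_le (μ := μ) univ_mem hF_meas hF_int hF'_meas
    h_bound (integrable_const _) h_diff).2

/-- `∂_z(K, g)_θ = (K, ∂_zg)_θ`, `deriv` form. [folklore] -/
theorem deriv_kMoment {g : ℝ → ℝ → ℝ} (hg : ContDiff ℝ 1 (uncurry g))
    (hs : HasCompactSupport (uncurry g)) (z : ℝ) : deriv (kMoment g) z = kMoment (dz g) z :=
  (hasDerivAt_kMoment hg hs z).deriv

/-- **`D_z(K, g)_θ = (K, D_zg)_θ`**. [cite: Elgindi2021, §6.3 proof of Proposition 6.13 ("L₁₂ is actually smoothing in θ") (p. 18 of arXiv:1904.04795)] -/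
theorem Dz₁_kMoment {g : ℝ → ℝ → ℝ} (hg : ContDiff ℝ 1 (uncurry g))
    (hs : HasCompactSupport (uncurry g)) (z : ℝ) : Dz₁ (kMoment g) z = kMoment (Dz g) z := by
  rw [Dz₁_apply, deriv_kMoment hg hs, kMoment_def, kMoment_def, ← integral_const_mul]
  refine integral_congr_ae (Filter.Eventually.of_forall fun θ => ?_)
  simp only [Dz_eq_mul_dz]
  ring

/-- **`(K, g)_θ ∈ Cⁿ` for `g ∈ Cⁿ` compactly supported.** [folklore] -/
theorem contDiff_kMoment {g : ℝ → ℝ → ℝ} {n : ℕ} (hg : ContDiff ℝ n (uncurry g))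
    (hs : HasCompactSupport (uncurry g)) : ContDiff ℝ n (kMoment g) := by
  induction n generalizing g with
  | zero => exact_mod_cast contDiff_zero.2 (continuous_kMoment hg.continuous)
  | succ n ih =>
    have hg1 : ContDiff ℝ 1 (uncurry g) := hg.of_le (by exact_mod_cast Nat.le_add_left 1 n)
    have hd : ∀ z, HasDerivAt (kMoment g) (kMoment (dz g) z) z := hasDerivAt_kMoment hg1 hs
    have e : deriv (kMoment g) = kMoment (dz g) := funext fun z => (hd z).deriv
    have hdz : ContDiff ℝ n (uncurry (dz g)) := contDiff_dz_of_contDiff (by exact_mod_cast hg)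
    rw [show ((n + 1 : ℕ) : WithTop ℕ∞) = (n : ℕ) + 1 by push_cast; rfl, contDiff_succ_iff_deriv]
    refine ⟨fun z => (hd z).differentiableAt, fun h => absurd h (by simp), ?_⟩
    rw [e]
    exact ih hdz (hasCompactSupport_dz hs)

/-- **Iterated: `D_z^m(K, g)_θ = (K, D_z^m g)_θ`** for `g ∈ C^m` compactly supported. [cite: Elgindi2021, §6.3 proof of Proposition 6.13 (p. 18 of arXiv:1904.04795); ElgindiGhoulMasmoudi2021, §3.1 proof of Proposition 3.2 (p. 10 of arXiv:1910.14071)] -/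
theorem iterate_Dz₁_kMoment {g : ℝ → ℝ → ℝ} {m : ℕ} (hg : ContDiff ℝ m (uncurry g))
    (hs : HasCompactSupport (uncurry g)) : ∀ z, Dz₁^[m] (kMoment g) z = kMoment (Dz^[m] g) z := by
  induction m generalizing g with
  | zero => intro z; rfl
  | succ m ih =>
    intro z
    have hg1 : ContDiff ℝ 1 (uncurry g) := hg.of_le (by exact_mod_cast Nat.le_add_left 1 m)
    have hDz : ContDiff ℝ m (uncurry (Dz g)) := contDiff_Dz_of_contDiff (by exact_mod_cast hg)
    have e : Dz₁ (kMoment g) = kMoment (Dz g) := funext fun z => Dz₁_kMoment hg1 hs z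
    rw [Function.iterate_succ_apply, Function.iterate_succ_apply, e]
    exact ih hDz (hasCompactSupport_Dz hs) z

/-! ### Radial derivatives of `L₁₂` -/

/-- **`D_zL₁₂(g) = −(K, g)_θ`** (everywhere; at `z = 0` both sides vanish), for `g` continuous,
compactly supported inside the open strip. [cite: Elgindi2021, §6.2 proof of Proposition 6.9 ("−D_z((2Γz/(c(1+z)²))L₁₂(f)) = … + (2Γz/(c(1+z)²))(K, f)_{L²_θ} …") (p. 17 of arXiv:1904.04795)] -/
theorem Dz₁_L12 {g : ℝ → ℝ → ℝ} (hg : Continuous (uncurry g)) (hs : HasCompactSupport (uncurry g))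
    (hsub : tsupport (uncurry g) ⊆ strip) (z : ℝ) : Dz₁ (L12 g) z = -kMoment g z := by
  rw [Dz₁_apply, deriv_L12 hg hs hsub z]
  by_cases hz : z = 0
  · obtain ⟨a, b, ha, -, hab⟩ := exists_radial_bounds' hs hsub
    rw [hz, kMoment_eq_zero_of_not_mem hab (Or.inl (by simpa using ha))]
    simp
  · field_simp

/-- `Dz₁` of a negative. [folklore] -/
theorem Dz₁_neg (c : ℝ → ℝ) : Dz₁ (fun z => -c z) = fun z => -Dz₁ c z := by
  funext z
  simp only [Dz₁_apply, deriv.fun_neg]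
  ring

/-- Iterates of `Dz₁` of a negative. [folklore] -/
theorem iterate_Dz₁_neg (c : ℝ → ℝ) (m : ℕ) : Dz₁^[m] (fun z => -c z) = fun z => -Dz₁^[m] c z := by
  induction m generalizing c with
  | zero => rfl
  | succ m ih => rw [Function.iterate_succ_apply, Function.iterate_succ_apply, Dz₁_neg, ih]

/-- **Iterated: `D_z^{m+1}L₁₂(g) = −(K, D_z^m g)_θ`** for `g ∈ C^m` compactly supported inside the
open strip — every radial derivative of `L₁₂(g)` is the `K`-moment of a lower derivative. [cite: Elgindi2021, §6.3 proof of Proposition 6.13 (p. 18 of arXiv:1904.04795); ElgindiGhoulMasmoudi2021, §3.1 proof of Proposition 3.2 (p. 10 of arXiv:1910.14071)] -/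
theorem iterate_Dz₁_L12 {g : ℝ → ℝ → ℝ} {m : ℕ} (hg : ContDiff ℝ m (uncurry g))
    (hs : HasCompactSupport (uncurry g)) (hsub : tsupport (uncurry g) ⊆ strip) (z : ℝ) :
    Dz₁^[m + 1] (L12 g) z = -kMoment (Dz^[m] g) z := by
  have e : Dz₁ (L12 g) = fun z => -kMoment g z := funext fun z => Dz₁_L12 hg.continuous hs hsub z
  rw [Function.iterate_succ_apply, e, iterate_Dz₁_neg]
  show -Dz₁^[m] (kMoment g) z = _
  rw [iterate_Dz₁_kMoment hg hs z]

/-- **`L₁₂(g) ∈ Cⁿ`** for `g ∈ Cⁿ` compactly supported inside the open strip (`n ≥ 1`; in fact one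
degree better). [folklore] -/
theorem contDiff_L12 {g : ℝ → ℝ → ℝ} {n : ℕ} (hg : ContDiff ℝ n (uncurry g))
    (hs : HasCompactSupport (uncurry g)) (hsub : tsupport (uncurry g) ⊆ strip) : ContDiff ℝ n (L12 g) := by
  obtain ⟨a, b, ha, -, hab⟩ := exists_radial_bounds' hs hsub
  have hd : ∀ z, HasDerivAt (L12 g) (-(kMoment g z / z)) z := hasDerivAt_L12 hg.continuous hs hsub
  -- the derivative `−(K,g)_θ/z` agrees with the smooth function `−(K,g)_θ · u(z)` where `u` is any
  -- smooth function equal to `1/z` on `[a, ∞)`; we avoid this by writing it as `(K, g/z)_θ`.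
  set h : ℝ → ℝ → ℝ := fun z θ => -(g z θ / z) with hh
  have hK : ∀ z, -(kMoment g z / z) = kMoment h z := by
    intro z
    rw [kMoment_def, kMoment_def, ← integral_div, ← integral_neg]
    refine integral_congr_ae (Filter.Eventually.of_forall fun θ => ?_)
    simp only [hh]
    ring
  have hg0 : ∀ p : ℝ × ℝ, p.1 < a → g p.1 p.2 = 0 := by
    intro p hp
    by_contra hne
    exact absurd (hab p.1 p.2 hne).1 (not_le.2 hp)
  have hhC : ContDiff ℝ n (uncurry h) := by
    have hu : ContDiffOn ℝ n (fun p : ℝ × ℝ => -(g p.1 p.2 / p.1)) {p : ℝ × ℝ | a / 2 < p.1} :=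
      ((hg.contDiffOn.div (contDiffOn_fst) fun p hp => by
        have : a / 2 < p.1 := hp; exact (by linarith : p.1 ≠ 0)).neg)
    refine contDiff_iff_contDiffAt.2 fun p => ?_
    by_cases hp : a / 2 < p.1
    · exact (hu.contDiffAt ((isOpen_lt continuous_const continuous_fst).mem_nhds hp)).congr_of_eventuallyEq
        (Filter.Eventually.of_forall fun q => rfl)
    · -- near `p` (with `p.1 ≤ a/2 < a`) the function vanishes identically
      have hev : (uncurry h) =ᶠ[𝓝 p] fun _ => 0 := by
        have hopen : IsOpen {q : ℝ × ℝ | q.1 < a} := isOpen_lt continuous_fst continuous_const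
        have hmem : p ∈ {q : ℝ × ℝ | q.1 < a} := by
          show p.1 < a; linarith [not_lt.1 hp]
        refine Filter.eventuallyEq_of_mem (hopen.mem_nhds hmem) fun q hq => ?_
        simp only [Function.uncurry, hh, hg0 q hq, zero_div, neg_zero]
      exact (contDiffAt_const.congr_of_eventuallyEq hev)
  have hhs : HasCompactSupport (uncurry h) := by
    refine HasCompactSupport.intro hs fun p hp => ?_
    have h0 : g p.1 p.2 = 0 := (image_eq_zero_of_notMem_tsupport hp : uncurry g p = 0)
    simp only [Function.uncurry, hh, h0, zero_div, neg_zero]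
  have e : deriv (L12 g) = kMoment h := funext fun z => by rw [(hd z).deriv, hK z]
  cases n with
  | zero => exact_mod_cast contDiff_zero.2 (continuous_L12 hg.continuous hs hsub)
  | succ n =>
    rw [show ((n + 1 : ℕ) : WithTop ℕ∞) = (n : ℕ) + 1 by push_cast; rfl, contDiff_succ_iff_deriv]
    refine ⟨fun z => (hd z).differentiableAt, fun h => absurd h (by simp), ?_⟩
    rw [e]
    exact contDiff_kMoment (hhC.of_le (by exact_mod_cast Nat.le_succ n)) hhs

end Elgindi

end Literature.Analysis.FluidPDE
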